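import Mathlib
import Literature.Analysis.FluidPDE.WholeSpaceIBPIntegrable
import Literature.Analysis.FluidPDE.EnergyToolkit
import HarnessLib

/-!
# `RootDecompLitSlice` — the slice TERM BOUNDS of the mean-field one-step
# (helpers toward `CritTameScarIsCritical`, stmt-NavierStokesRegularity-31733)

Fifth helper file of the mean-field lever (cell `decomp-ns`, gen 43). The conditional theorems of
`RootDecompLitSliceMeanFieldBootstrap.lean` (p837180) and `…MeanFieldEndpoint.lean` (p837169)
carry ONE analytic antecedent each: the one-step improvement `hstep` of the energy-drop law,
resp. the linear endpoint bound `hlin`. Both come from testing the Navier–Stokes equation of the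
moving slice `v = u(t)` against the FIXED final slice `w = u(T)` and bounding the two resulting
pairings slice by slice (blueprint B5–B6 in the cell tree):

* the TRANSPORT pairing `T2 = ∫ ⟪(v·∇)v, w⟫`, which after antisymmetrisation only sees the
  fluctuation `v − w`:  `∫ ⟪(v·∇)v, w⟫ = −∫ ⟪v − w, (v·∇)w⟫` (`div v = 0`), hence
  `|T2| ≤ ‖v − w‖₃ ‖Dw‖₂ ‖v‖₆` (Hölder `1/3 + 1/2 + 1/6 = 1`);
* the VISCOUS cross pairing `T3 = ∫ Σᵢ ⟪∂ᵢv, ∂ᵢw⟫`, with `|T3| ≤ (∫ |Dv|²)^{1/2} (∫ |Dw|²)^{1/2}`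
  in the Frobenius currency `∫ frobeniusNormSq (D·)` of the tame energy identity
  (`RootDecompLitSliceEnergyClockDissipation.lean`).

Contents (everything PROVED, def-free, standard axioms):

* §1 `integral_inner_convect_add_eq_zero_of_isDivFree`, `integral_inner_convect_self_eq_zero_of_isDivFree`,
  `integral_inner_convect_self_left_eq` — the trilinear identities for a divergence-free drift under
  `L¹` hypotheses (no compact support: the fixed slice `u(T)` is not compactly supported), from the
  tree's `integral_mul_divergence_add_eq_zero_of_integrable` (`WholeSpaceIBPIntegrable.lean`);
* §2 `lintegral_mul_mul_le_L3_L2_L6`, `integral_norm_mul_mul_le` — three-factor Hölder `3·2·6`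
  (`ℝ≥0∞` and real forms), from Mathlib's `ENNReal.lintegral_mul_le_Lp_mul_Lq` /
  `ENNReal.lintegral_Lp_mul_le_Lq_mul_Lr`;
* §3 `abs_sum_inner_apply_le_sqrt_mul_sqrt`, `abs_integral_sum_inner_fderiv_le` — Cauchy–Schwarz for
  the Frobenius pairing, pointwise and integrated;
* §4 `abs_integral_inner_convect_le` — the transport TERM BOUND `|T2| ≤ ‖v − w‖₃ ‖Dw‖₂ ‖v‖₆`.

The remaining slice inputs of the one-step are already in the tree and are cited by name, not
restated: Sobolev `‖v‖₆ ≤ K ‖Dv‖₂` (`eLpNorm_six_le_eLpNorm_fderiv_two`, `SobolevWholeSpace.lean`),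
`‖L‖² ≤ frobeniusNormSq L` (`sq_opNorm_le_frobeniusNormSq`), the `L⁴`/`L³` interpolations
(`integral_norm_pow_four_le`, `EnergyToolkit.lean`).

References: J. Leray, Acta Math. 63 (1934) §6 (1.11), §27 [Leray1934]; A. J. Majda,
A. L. Bertozzi, *Vorticity and Incompressible Flow* (2002) §1.2, §3.1 [MajdaBertozzi2002];
L. C. Evans, *PDE* (2010) App. B.2, C.2 [Evans2010].
-/

set_option linter.dupNamespace false

namespace Summit.NavierStokesRegularity.NavierStokesRegularity.Theorems

open MeasureTheory Set Filter Topology InnerProductSpace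
open scoped RealInnerProductSpace ENNReal NNReal
open Literature.Analysis.FluidPDE

namespace MeanFieldTrilinear

/-! ## §1 Trilinear identities for a divergence-free drift, `L¹` form -/

section Trilinear

variable {E : Type*} [NormedAddCommGroup E] [InnerProductSpace ℝ E] [FiniteDimensional ℝ E]
  [MeasurableSpace E] [BorelSpace E]
variable {F' : Type*} [NormedAddCommGroup F'] [InnerProductSpace ℝ F']

/-- **Trilinear identity for a divergence-free drift, `L¹` form.** For `C¹` fields `u : E → E`
(divergence-free), `v, φ : E → F'` with `⟪v, φ⟫ u`, `⟪(u·∇)v, φ⟫`, `⟪v, (u·∇)φ⟫` integrable,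
`∫ ⟪(u·∇)v, φ⟫ + ∫ ⟪v, (u·∇)φ⟫ = 0` (`div (⟪v,φ⟫ u) = ⟪(u·∇)v, φ⟫ + ⟪v, (u·∇)φ⟫` when `div u = 0`,
and `∫ θ div u + ∫ ⟪u, ∇θ⟫ = 0` for integrable data, `integral_mul_divergence_add_eq_zero_of_integrable`;
Leray 1934 §6 (1.11), Majda–Bertozzi §1.2). [folklore] -/
theorem integral_inner_convect_add_eq_zero_of_isDivFree {u : E → E} {v φ : E → F'}
    (hu : ContDiff ℝ 1 u) (hv : ContDiff ℝ 1 v) (hφ : ContDiff ℝ 1 φ)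
    (hdiv : VectorCalculus.IsDivFree u)
    (h0 : Integrable (fun x => ⟪v x, φ x⟫ • u x))
    (h1 : Integrable (fun x => ⟪convect u v x, φ x⟫))
    (h2 : Integrable (fun x => ⟪v x, convect u φ x⟫)) :
    (∫ x, ⟪convect u v x, φ x⟫) + ∫ x, ⟪v x, convect u φ x⟫ = 0 := by
  have hθ : ContDiff ℝ 1 fun x => ⟪v x, φ x⟫ := hv.inner ℝ hφ
  have hgrad : ∀ x, ⟪u x, gradient (fun y => ⟪v y, φ y⟫) x⟫ =
      ⟪convect u v x, φ x⟫ + ⟪v x, convect u φ x⟫ := fun x => by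
    rw [gradient, real_inner_comm, InnerProductSpace.toDual_symm_apply,
      fderiv_inner_apply ℝ (hv.differentiable one_ne_zero x) (hφ.differentiable one_ne_zero x)]
    simp [convect, add_comm]
  have h12 : Integrable (fun x => ⟪u x, gradient (fun y => ⟪v y, φ y⟫) x⟫) := by
    simp_rw [hgrad]; exact h1.add h2
  have hzero : (fun x => ⟪v x, φ x⟫ * VectorCalculus.divergence u x) = fun _ => 0 := by
    funext x; rw [hdiv x, mul_zero]
  have h3 : Integrable fun x => ⟪v x, φ x⟫ * VectorCalculus.divergence u x := by
    rw [hzero]; exact integrable_zero _ _ _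
  have h := integral_mul_divergence_add_eq_zero_of_integrable hθ hu h0 h3 h12
  rw [hzero, integral_zero, zero_add, integral_congr_ae (Eventually.of_forall hgrad),
    integral_add h1 h2] at h
  exact h

/-- **`∫ ⟪(u·∇)w, w⟫ = 0` for a divergence-free drift**, `L¹` form (the case `v = φ = w` of
`integral_inner_convect_add_eq_zero_of_isDivFree`; Majda–Bertozzi §1.2, §3.1). [folklore] -/
theorem integral_inner_convect_self_eq_zero_of_isDivFree {u : E → E} {w : E → F'}
    (hu : ContDiff ℝ 1 u) (hw : ContDiff ℝ 1 w) (hdiv : VectorCalculus.IsDivFree u)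
    (h0 : Integrable (fun x => ⟪w x, w x⟫ • u x))
    (h1 : Integrable (fun x => ⟪convect u w x, w x⟫)) :
    ∫ x, ⟪convect u w x, w x⟫ = 0 := by
  have hcomm : (fun x => ⟪w x, convect u w x⟫) = fun x => ⟪convect u w x, w x⟫ := by
    funext x; exact real_inner_comm _ _
  have h2 : Integrable (fun x => ⟪w x, convect u w x⟫) := by rw [hcomm]; exact h1
  have h := integral_inner_convect_add_eq_zero_of_isDivFree hu hw hw hdiv h0 h1 h2
  rw [hcomm] at h
  linarith

/-- **Antisymmetrisation of the transport pairing against a fixed field.** For a divergence-free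
`C¹` field `v : E → E` and a `C¹` field `w : E → E` (all pairings integrable),
`∫ ⟪(v·∇)v, w⟫ = −∫ ⟪v − w, (v·∇)w⟫`: the self-pairing `∫ ⟪(v·∇)w, w⟫` vanishes, so only the
FLUCTUATION `v − w` is paired with the gradient of `w` — the structural reason the transport term of
the mean-field one-step carries a factor `‖u(t) − u(T)‖` (Leray 1934 §27; Majda–Bertozzi §3.1). [folklore] -/
theorem integral_inner_convect_self_left_eq {v w : E → E} (hv : ContDiff ℝ 1 v)
    (hw : ContDiff ℝ 1 w) (hdiv : VectorCalculus.IsDivFree v)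
    (h0 : Integrable (fun x => ⟪v x, w x⟫ • v x)) (h0' : Integrable (fun x => ⟪w x, w x⟫ • v x))
    (h1 : Integrable (fun x => ⟪convect v v x, w x⟫))
    (h2 : Integrable (fun x => ⟪v x, convect v w x⟫))
    (h3 : Integrable (fun x => ⟪convect v w x, w x⟫)) :
    ∫ x, ⟪convect v v x, w x⟫ = -∫ x, ⟪v x - w x, convect v w x⟫ := by
  have hA := integral_inner_convect_add_eq_zero_of_isDivFree hv hv hw hdiv h0 h1 h2
  have hB := integral_inner_convect_self_eq_zero_of_isDivFree hv hw hdiv h0' h3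
  have hcomm : (fun x => ⟪w x, convect v w x⟫) = fun x => ⟪convect v w x, w x⟫ := by
    funext x; exact real_inner_comm _ _
  have h3' : Integrable (fun x => ⟪w x, convect v w x⟫) := by rw [hcomm]; exact h3
  have hB' : ∫ x, ⟪w x, convect v w x⟫ = 0 := by rw [hcomm]; exact hB
  have hsplit : ∫ x, ⟪v x - w x, convect v w x⟫ =
      (∫ x, ⟪v x, convect v w x⟫) - ∫ x, ⟪w x, convect v w x⟫ := by
    simp_rw [inner_sub_left]; exact integral_sub h2 h3'
  linarith

omit [FiniteDimensional ℝ E] [MeasurableSpace E] [BorelSpace E] in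
/-- Pointwise size of the antisymmetrised pairing: `|⟪a, (v·∇)w (x)⟫| ≤ ‖a‖ ‖Dw(x)‖ ‖v x‖`
(`(v·∇)w (x) = Dw(x) (v x)` and the operator norm). [folklore] -/
theorem abs_inner_convect_le {v : E → E} {w : E → F'} (a : F') (x : E) :
    |⟪a, convect v w x⟫| ≤ ‖a‖ * (‖fderiv ℝ w x‖ * ‖v x‖) := by
  refine (abs_real_inner_le_norm _ _).trans (mul_le_mul_of_nonneg_left ?_ (norm_nonneg _))
  exact ContinuousLinearMap.le_opNorm _ _

end Trilinear

/-! ## §2 Three-factor Hölder `3 · 2 · 6` -/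

section Holder

variable {α : Type*} [MeasurableSpace α] (μ : Measure α)
variable {F₁ F₂ F₃ : Type*} [NormedAddCommGroup F₁] [NormedAddCommGroup F₂] [NormedAddCommGroup F₃]

/-- `eLpNorm f n μ = (∫⁻ ‖f‖ₑ ^ n) ^ (1/n)` for a natural exponent `n ≠ 0`. [folklore] -/
theorem eLpNorm_eq_lintegral_rpow_of_nat {f : α → F₁} (n : ℕ) (hn : n ≠ 0) :
    eLpNorm f n μ = (∫⁻ x, ‖f x‖ₑ ^ (n : ℝ) ∂μ) ^ (1 / (n : ℝ)) := by
  rw [eLpNorm_eq_lintegral_rpow_enorm_toReal (by exact_mod_cast hn) (ENNReal.natCast_ne_top n),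
    ENNReal.toReal_natCast]

/-- **Three-factor Hölder `3 · 2 · 6`** (`1/3 + 1/2 + 1/6 = 1`), `ℝ≥0∞` form:
`∫⁻ ‖f‖ ‖g‖ ‖h‖ ≤ ‖f‖₃ ‖g‖₂ ‖h‖₆` (Hölder `3, 3/2`, then `‖g h‖_{3/2} ≤ ‖g‖₂ ‖h‖₆`;
Evans, *PDE*, App. B.2). [folklore] -/
theorem lintegral_mul_mul_le_L3_L2_L6 {f : α → F₁} {g : α → F₂} {h : α → F₃}
    (hf : AEStronglyMeasurable f μ) (hg : AEStronglyMeasurable g μ)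
    (hh : AEStronglyMeasurable h μ) :
    ∫⁻ x, ‖f x‖ₑ * (‖g x‖ₑ * ‖h x‖ₑ) ∂μ ≤ eLpNorm f 3 μ * (eLpNorm g 2 μ * eLpNorm h 6 μ) := by
  have hF : AEMeasurable (fun x => ‖f x‖ₑ) μ := hf.enorm
  have hG : AEMeasurable (fun x => ‖g x‖ₑ) μ := hg.enorm
  have hH : AEMeasurable (fun x => ‖h x‖ₑ) μ := hh.enorm
  have hpq : (3 : ℝ).HolderConjugate (3 / 2) := ⟨by norm_num, by norm_num, by norm_num⟩
  have h1 := ENNReal.lintegral_mul_le_Lp_mul_Lq μ hpq hF (hG.mul hH)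
  have h2 := ENNReal.lintegral_Lp_mul_le_Lq_mul_Lr (p := 3 / 2) (q := 2) (r := 6) (by norm_num)
    (by norm_num) (by norm_num) μ hG hH
  have e3 : eLpNorm f 3 μ = (∫⁻ x, ‖f x‖ₑ ^ (3 : ℝ) ∂μ) ^ (1 / (3 : ℝ)) := by
    simpa using eLpNorm_eq_lintegral_rpow_of_nat μ (f := f) 3 (by norm_num)
  have e2 : eLpNorm g 2 μ = (∫⁻ x, ‖g x‖ₑ ^ (2 : ℝ) ∂μ) ^ (1 / (2 : ℝ)) := by
    simpa using eLpNorm_eq_lintegral_rpow_of_nat μ (f := g) 2 (by norm_num)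
  have e6 : eLpNorm h 6 μ = (∫⁻ x, ‖h x‖ₑ ^ (6 : ℝ) ∂μ) ^ (1 / (6 : ℝ)) := by
    simpa using eLpNorm_eq_lintegral_rpow_of_nat μ (f := h) 6 (by norm_num)
  rw [e3, e2, e6]
  exact h1.trans (mul_le_mul' le_rfl h2)

/-- **Three-factor Hölder `3 · 2 · 6`**, real form: for `f ∈ L³`, `g ∈ L²`, `h ∈ L⁶` the product
of norms is integrable and `∫ ‖f‖ ‖g‖ ‖h‖ ≤ ‖f‖₃ ‖g‖₂ ‖h‖₆` (Evans, *PDE*, App. B.2). [folklore] -/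
theorem integral_norm_mul_mul_le {f : α → F₁} {g : α → F₂} {h : α → F₃}
    (hf : MemLp f 3 μ) (hg : MemLp g 2 μ) (hh : MemLp h 6 μ) :
    Integrable (fun x => ‖f x‖ * (‖g x‖ * ‖h x‖)) μ ∧
    ∫ x, ‖f x‖ * (‖g x‖ * ‖h x‖) ∂μ ≤
      (eLpNorm f 3 μ).toReal * ((eLpNorm g 2 μ).toReal * (eLpNorm h 6 μ).toReal) := by
  have hle := lintegral_mul_mul_le_L3_L2_L6 μ hf.1 hg.1 hh.1
  have htop : eLpNorm f 3 μ * (eLpNorm g 2 μ * eLpNorm h 6 μ) ≠ ⊤ :=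
    ENNReal.mul_ne_top hf.eLpNorm_ne_top (ENNReal.mul_ne_top hg.eLpNorm_ne_top hh.eLpNorm_ne_top)
  have hmeas : AEStronglyMeasurable (fun x => ‖f x‖ * (‖g x‖ * ‖h x‖)) μ :=
    hf.1.norm.mul (hg.1.norm.mul hh.1.norm)
  have henorm : ∀ x, ‖‖f x‖ * (‖g x‖ * ‖h x‖)‖ₑ = ‖f x‖ₑ * (‖g x‖ₑ * ‖h x‖ₑ) := fun x => by
    rw [enorm_mul, enorm_mul, enorm_norm, enorm_norm, enorm_norm]
  have hlin : ∫⁻ x, ‖‖f x‖ * (‖g x‖ * ‖h x‖)‖ₑ ∂μ = ∫⁻ x, ‖f x‖ₑ * (‖g x‖ₑ * ‖h x‖ₑ) ∂μ :=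
    lintegral_congr fun x => henorm x
  have hint : Integrable (fun x => ‖f x‖ * (‖g x‖ * ‖h x‖)) μ :=
    ⟨hmeas, by rw [HasFiniteIntegral, hlin]; exact hle.trans_lt (lt_top_iff_ne_top.2 htop)⟩
  refine ⟨hint, ?_⟩
  have hnn : 0 ≤ᵐ[μ] fun x => ‖f x‖ * (‖g x‖ * ‖h x‖) :=
    Eventually.of_forall fun x => by positivity
  rw [integral_eq_lintegral_of_nonneg_ae hnn hmeas, ← ENNReal.toReal_mul, ← ENNReal.toReal_mul]
  refine ENNReal.toReal_mono htop ?_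
  calc ∫⁻ x, ENNReal.ofReal (‖f x‖ * (‖g x‖ * ‖h x‖)) ∂μ
      = ∫⁻ x, ‖f x‖ₑ * (‖g x‖ₑ * ‖h x‖ₑ) ∂μ := by
        refine lintegral_congr fun x => ?_
        rw [← henorm x, Real.enorm_eq_ofReal (by positivity)]
    _ ≤ _ := hle

end Holder

/-! ## §3 Cauchy–Schwarz for the Frobenius pairing (the viscous cross term `T3`) -/

section Viscous

variable {E : Type*} [NormedAddCommGroup E] [InnerProductSpace ℝ E] [FiniteDimensional ℝ E]
variable {F' : Type*} [NormedAddCommGroup F'] [InnerProductSpace ℝ F']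

/-- **Cauchy–Schwarz for the Frobenius pairing**, pointwise:
`|Σᵢ ⟪L eᵢ, M eᵢ⟫| ≤ |L|_F |M|_F` with `|L|_F² = frobeniusNormSq L = Σᵢ ‖L eᵢ‖²`
(Majda–Bertozzi §1.2). [folklore] -/
theorem abs_sum_inner_apply_le_sqrt_mul_sqrt (L M : E →L[ℝ] F') :
    |∑ i, ⟪L (stdOrthonormalBasis ℝ E i), M (stdOrthonormalBasis ℝ E i)⟫| ≤
      Real.sqrt (frobeniusNormSq L) * Real.sqrt (frobeniusNormSq M) := by
  refine (Finset.abs_sum_le_sum_abs _ _).trans ?_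
  refine (Finset.sum_le_sum fun i _ => abs_real_inner_le_norm _ _).trans ?_
  exact Real.sum_mul_le_sqrt_mul_sqrt _ _ _

variable [MeasurableSpace E] [BorelSpace E]

/-- **The viscous cross term is controlled by the two dissipations**:
`|∫ Σᵢ ⟪∂ᵢu, ∂ᵢw⟫| ≤ (∫ |Du|_F²)^{1/2} (∫ |Dw|_F²)^{1/2}` for fields with integrable dissipation
densities (pointwise Cauchy–Schwarz, then Cauchy–Schwarz in `L²`; the currency `∫ frobeniusNormSq (D·)`
is that of the tame energy identity). [folklore] -/
theorem abs_integral_sum_inner_fderiv_le {u w : E → F'}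
    (hu : Integrable (fun x => frobeniusNormSq (fderiv ℝ u x)))
    (hw : Integrable (fun x => frobeniusNormSq (fderiv ℝ w x))) :
    |∫ x, ∑ i, ⟪fderiv ℝ u x (stdOrthonormalBasis ℝ E i), fderiv ℝ w x (stdOrthonormalBasis ℝ E i)⟫| ≤
      Real.sqrt (∫ x, frobeniusNormSq (fderiv ℝ u x)) *
        Real.sqrt (∫ x, frobeniusNormSq (fderiv ℝ w x)) := by
  set F : E → ℝ := fun x => Real.sqrt (frobeniusNormSq (fderiv ℝ u x)) with hF
  set G : E → ℝ := fun x => Real.sqrt (frobeniusNormSq (fderiv ℝ w x)) with hG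
  have hFm : AEStronglyMeasurable F volume :=
    Real.continuous_sqrt.comp_aestronglyMeasurable hu.aestronglyMeasurable
  have hGm : AEStronglyMeasurable G volume :=
    Real.continuous_sqrt.comp_aestronglyMeasurable hw.aestronglyMeasurable
  have hF2 : MemLp F 2 volume := by
    refine (memLp_two_iff_integrable_sq hFm).2 ?_
    refine hu.congr (Eventually.of_forall fun x => ?_)
    simp only [hF, Real.sq_sqrt (frobeniusNormSq_nonneg _)]
  have hG2 : MemLp G 2 volume := by
    refine (memLp_two_iff_integrable_sq hGm).2 ?_
    refine hw.congr (Eventually.of_forall fun x => ?_)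
    simp only [hG, Real.sq_sqrt (frobeniusNormSq_nonneg _)]
  -- `F G ≤ (F² + G²)/2` gives integrability of the product
  have hFG : Integrable (fun x => F x * G x) := by
    refine Integrable.mono' ((hu.add hw).div_const 2) (hFm.mul hGm) (Eventually.of_forall fun x => ?_)
    rw [Real.norm_eq_abs, abs_of_nonneg (mul_nonneg (Real.sqrt_nonneg _) (Real.sqrt_nonneg _))]
    have h2 : 2 * F x * G x ≤ F x ^ 2 + G x ^ 2 := two_mul_le_add_sq (F x) (G x)
    simp only [hF, hG, Real.sq_sqrt (frobeniusNormSq_nonneg _), Pi.add_apply] at h2 ⊢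
    linarith
  have hCS := integral_mul_le_sqrt_mul_sqrt_of_memLp hF2 hG2
  have hsqF : ∫ x, F x ^ 2 = ∫ x, frobeniusNormSq (fderiv ℝ u x) :=
    integral_congr_ae (Eventually.of_forall fun x => by
      simp only [hF, Real.sq_sqrt (frobeniusNormSq_nonneg _)])
  have hsqG : ∫ x, G x ^ 2 = ∫ x, frobeniusNormSq (fderiv ℝ w x) :=
    integral_congr_ae (Eventually.of_forall fun x => by
      simp only [hG, Real.sq_sqrt (frobeniusNormSq_nonneg _)])
  rw [hsqF, hsqG] at hCS
  rw [← Real.norm_eq_abs]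
  refine (norm_integral_le_of_norm_le hFG (Eventually.of_forall fun x => ?_)).trans hCS
  rw [Real.norm_eq_abs]
  exact abs_sum_inner_apply_le_sqrt_mul_sqrt _ _

end Viscous

/-! ## §4 The transport term bound `|T2| ≤ ‖v − w‖₃ ‖Dw‖₂ ‖v‖₆` -/

section Transport

variable {E : Type*} [NormedAddCommGroup E] [InnerProductSpace ℝ E] [FiniteDimensional ℝ E]
  [MeasurableSpace E] [BorelSpace E]

/-- **The transport term of the mean-field one-step.** For a divergence-free `C¹` field `v` (the
moving slice `u(t)`) and a `C¹` field `w` (the fixed slice `u(T)`) with the pairings integrable,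
`v − w ∈ L³`, `Dw ∈ L²`, `v ∈ L⁶`:
`|∫ ⟪(v·∇)v, w⟫| ≤ ‖v − w‖_{L³} ‖Dw‖_{L²} ‖v‖_{L⁶}`
(antisymmetrisation `integral_inner_convect_self_left_eq` + Hölder `3·2·6`). This is the slice
estimate that makes the transport contribution to the energy drop `E(t) − E(T)` quadratic in the
fluctuation clock `‖u(t) − u(T)‖` (Leray 1934 §27; Majda–Bertozzi §3.1). [folklore] -/
theorem abs_integral_inner_convect_le {v w : E → E} (hv : ContDiff ℝ 1 v)
    (hw : ContDiff ℝ 1 w) (hdiv : VectorCalculus.IsDivFree v)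
    (h0 : Integrable (fun x => ⟪v x, w x⟫ • v x)) (h0' : Integrable (fun x => ⟪w x, w x⟫ • v x))
    (h1 : Integrable (fun x => ⟪convect v v x, w x⟫))
    (h2 : Integrable (fun x => ⟪v x, convect v w x⟫))
    (h3 : Integrable (fun x => ⟪convect v w x, w x⟫))
    (h3v : MemLp (fun x => v x - w x) 3 volume) (h2w : MemLp (fderiv ℝ w) 2 volume)
    (h6v : MemLp v 6 volume) :
    |∫ x, ⟪convect v v x, w x⟫| ≤ (eLpNorm (fun x => v x - w x) 3 volume).toReal *
      ((eLpNorm (fderiv ℝ w) 2 volume).toReal * (eLpNorm v 6 volume).toReal) := by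
  rw [integral_inner_convect_self_left_eq hv hw hdiv h0 h0' h1 h2 h3, abs_neg]
  obtain ⟨hint, hle⟩ := integral_norm_mul_mul_le volume h3v h2w h6v
  rw [← Real.norm_eq_abs]
  refine (norm_integral_le_of_norm_le hint (Eventually.of_forall fun x => ?_)).trans hle
  rw [Real.norm_eq_abs]
  exact abs_inner_convect_le _ _

end Transport

end MeanFieldTrilinear

end Summit.NavierStokesRegularity.NavierStokesRegularity.Theorems
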